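import Summits.AtomisticToContinuum.Crystallization.Theorems.FrustratedLawDichotomyWindowEnergyCeiling

/-!
# Route `FrustratedLawDichotomy`, crux `TexturedLawTransfer` (stmt-AtomisticToContinuum-27625):
registered stub `stub_windowGrowth` of the skeleton line «truncated-bs»

**Window growth (no tendrils).**  For every `n₀` there is a radius `r₀` such that in every finite Lennard-Jones
ground state with `N ≥ n₀` particles, EVERY particle has at least `n₀` particles (itself included) within
distance `r₀`.

Proof (docking + tails, elementary):
* DOCKING.  Let `A` be a set of particles of a ground state `w` and suppose all cross distances between `A` and
  `Aᶜ` exceed `2`.  Translate `A` rigidly by integer multiples `k·u` of the unit vector `u` pointing from some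
  `w_a₀` (`a₀ ∈ A`) to some `w_b₀` (`b₀ ∉ A`); the largest integer step `k ≤ |w_a₀ − w_b₀|` keeping all cross
  distances `≥ 1` leaves some cross pair at distance `∈ [1, 2]` (otherwise one more step is admissible).  The
  translated configuration is injective, has the same internal energies of `A` and `Aᶜ`, all its cross terms are
  `≤ 0` (`V_LJ ≤ 0` on `[1, ∞)`) and one is `≤ V`-bound `−1/768` (`V_LJ ≤ −1/768` on `[1, 2]`); minimality of the
  ground state then forces the ORIGINAL cross energy `Σ_(A×Aᶜ) V_LJ ≤ −1/1536` (`cross_le_of_dock`).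
* TAILS.  If all cross distances exceeded `G`, the cross energy would be `≥ −(1/6)·250 δ⁻⁵ G⁻¹ · #A`
  (`V_LJ(t) ≥ −t⁻⁶/6`, ground states are `δ = 1/3`-separated, `ChargedPeriodicOptimal.sum_inv_pow_six_far_le`);
  so some cross pair is within `G(#A) = 64000 δ⁻⁵ #A + 2` (`exists_cross_pair_le`).
* GROWTH.  Starting from `{i}`, add `n₀ − 1` times a nearest outside particle: `n₀` particles within
  `r₀ = n₀ · G(n₀)` of `w_i`.
-/

namespace Summit.AtomisticToContinuum.Crystallization.Theorems.FrustratedLawDichotomyWindowGrowth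

open Literature.MathematicalPhysics.StatisticalMechanics

variable {N : ℕ}

/-- `V_LJ ≤ −1/768` on `[1, 2]` (`V_LJ(t) = (t⁻⁶/6)(t⁻⁶/2 − 1) ≤ −t⁻⁶/12 ≤ −2⁻⁶/12`). [folklore] -/
theorem lennardJones_le_of_mem_Icc {t : ℝ} (h1 : 1 ≤ t) (h2 : t ≤ 2) : lennardJones t ≤ -(1 / 768) := by
  unfold lennardJones
  have ht : 0 < t := by linarith
  have ha1 : t⁻¹ ≤ 1 := inv_le_one_of_one_le₀ h1
  have ha0 : 0 ≤ t⁻¹ := inv_nonneg.2 ht.le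
  have ha2 : (2 : ℝ)⁻¹ ≤ t⁻¹ := inv_anti₀ ht h2
  set a := (t⁻¹) ^ 6 with ha
  have hA1 : a ≤ 1 := pow_le_one₀ ha0 ha1
  have hA2 : (1 / 64 : ℝ) ≤ a := by
    have h := pow_le_pow_left₀ (by norm_num : (0 : ℝ) ≤ 2⁻¹) ha2 6
    rw [show ((2 : ℝ)⁻¹) ^ 6 = 1 / 64 by norm_num] at h
    exact h
  have h12 : (t⁻¹) ^ 12 = a * a := by rw [ha]; ring
  rw [h12]
  nlinarith [mul_le_mul_of_nonneg_right (by linarith : 1 - a ≤ 63 / 64) (by linarith : (0 : ℝ) ≤ 1 - a)]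

/-- Along the line: translating `p` by `t` times the unit vector towards `q` puts it at distance `|dist p q − t|`
from `q`. [folklore] -/
theorem dist_translate_line (p q : EuclideanSpace ℝ (Fin 3)) (hpq : p ≠ q) (t : ℝ) :
    dist (p + t • ((dist p q)⁻¹ • (q - p))) q = |dist p q - t| := by
  have hd0 : dist p q ≠ 0 := dist_ne_zero.2 hpq
  have hdpos : 0 < dist p q := dist_pos.2 hpq
  have hu : ‖(dist p q)⁻¹ • (q - p)‖ = 1 := by
    rw [norm_smul, norm_inv, Real.norm_of_nonneg hdpos.le, ← dist_eq_norm, dist_comm q p,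
      inv_mul_cancel₀ hd0]
  have hqp : (dist p q) • ((dist p q)⁻¹ • (q - p)) = q - p := by
    rw [smul_smul, mul_inv_cancel₀ hd0, one_smul]
  have key : p + t • ((dist p q)⁻¹ • (q - p)) - q = (t - dist p q) • ((dist p q)⁻¹ • (q - p)) := by
    rw [sub_smul, hqp]
    abel
  rw [dist_eq_norm, key, norm_smul, hu, mul_one, Real.norm_eq_abs, abs_sub_comm]

/-- The unit vector from `p` towards `q ≠ p` has norm `1`. [folklore] -/
theorem norm_dir_eq_one (p q : EuclideanSpace ℝ (Fin 3)) (hpq : p ≠ q) : ‖(dist p q)⁻¹ • (q - p)‖ = 1 := by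
  rw [norm_smul, norm_inv, Real.norm_of_nonneg dist_nonneg, ← dist_eq_norm, dist_comm q p,
    inv_mul_cancel₀ (dist_ne_zero.2 hpq)]

/-- A translation by `u` changes distances to a fixed point by at most `‖u‖`. [folklore] -/
theorem dist_add_left_ge (p u q : EuclideanSpace ℝ (Fin 3)) : dist p q - ‖u‖ ≤ dist (p + u) q := by
  have h := dist_triangle p (p + u) q
  have h2 : dist p (p + u) = ‖u‖ := by rw [dist_eq_norm]; simp
  linarith

/-- **Docking by integer steps.**  If all cross distances between `A` and `Aᶜ` exceed `2`, some integer
translation `k·u` of `A` along a unit vector `u` pointing from `w_a₀` (`a₀ ∈ A`) towards `w_b₀` (`b₀ ∉ A`) keeps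
all cross distances `≥ 1` and brings one cross pair within distance `2` (take the largest admissible
`k ≤ |w_a₀ − w_b₀|`). [folklore] -/
theorem exists_dock (w : Fin N → EuclideanSpace ℝ (Fin 3)) (A : Finset (Fin N)) {a₀ b₀ : Fin N} (ha₀ : a₀ ∈ A)
    (hb₀ : b₀ ∈ Aᶜ) (u : EuclideanSpace ℝ (Fin 3)) (hu1 : ‖u‖ = 1)
    (hline : ∀ t : ℝ, dist (w a₀ + t • u) (w b₀) = |dist (w a₀) (w b₀) - t|)
    (hfar : ∀ a ∈ A, ∀ b ∈ Aᶜ, 2 < dist (w a) (w b)) :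
    ∃ t : ℝ, (∀ a ∈ A, ∀ b ∈ Aᶜ, 1 ≤ dist (w a + t • u) (w b)) ∧
      ∃ a ∈ A, ∃ b ∈ Aᶜ, dist (w a + t • u) (w b) ≤ 2 := by
  classical
  set d₀ := dist (w a₀) (w b₀) with hd₀
  set T := (Finset.range (⌊d₀⌋₊ + 1)).filter
    (fun k : ℕ => ∀ a ∈ A, ∀ b ∈ Aᶜ, 1 ≤ dist (w a + (k : ℝ) • u) (w b)) with hT
  have h0T : 0 ∈ T := by
    refine Finset.mem_filter.2 ⟨Finset.mem_range.2 (Nat.succ_pos _), fun a ha b hb => ?_⟩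
    rw [Nat.cast_zero, zero_smul, add_zero]
    linarith [hfar a ha b hb]
  have hTne : T.Nonempty := ⟨0, h0T⟩
  set k := T.max' hTne with hk
  have hkT : k ∈ T := by rw [hk]; exact Finset.max'_mem T hTne
  have hk1 : ∀ a ∈ A, ∀ b ∈ Aᶜ, 1 ≤ dist (w a + (k : ℝ) • u) (w b) := (Finset.mem_filter.1 hkT).2
  have hkd : (k : ℝ) ≤ d₀ := by
    have h1 : k < ⌊d₀⌋₊ + 1 := Finset.mem_range.1 (Finset.mem_filter.1 hkT).1
    have h2 : k ≤ ⌊d₀⌋₊ := Nat.lt_succ_iff.1 h1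
    exact le_trans (by exact_mod_cast h2) (Nat.floor_le dist_nonneg)
  refine ⟨k, hk1, ?_⟩
  by_contra hcon
  push Not at hcon
  have h3 : 2 < d₀ - k := by
    have h := hcon a₀ ha₀ b₀ hb₀
    rwa [hline, abs_of_nonneg (by linarith)] at h
  have hk1T : k + 1 ∈ T := by
    refine Finset.mem_filter.2 ⟨Finset.mem_range.2 (Nat.lt_succ_of_le (Nat.le_floor ?_)), fun a ha b hb => ?_⟩
    · push_cast
      linarith
    · have h4 := dist_add_left_ge (w a + (k : ℝ) • u) u (w b)
      rw [hu1] at h4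
      have h5 : w a + ((k + 1 : ℕ) : ℝ) • u = w a + (k : ℝ) • u + u := by
        push_cast
        rw [add_smul, one_smul, add_assoc]
      rw [h5]
      linarith [hcon a ha b hb]
  have h6 := Finset.le_max' T (k + 1) hk1T
  rw [← hk] at h6
  omega

/-- **Cross energy after docking.**  If a translate `A + v` of the particles of `A` has all cross distances to
`Aᶜ` at least `1` and one cross distance at most `2`, then in a Lennard-Jones GROUND STATE the original cross
energy satisfies `Σ_(a∈A) Σ_(b∉A) V_LJ(|w_a − w_b|) ≤ −1/1536`: the docked configuration is an injective
competitor with the same internal energies, cross terms `≤ 0` and one cross term `≤ −1/768`.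
[cite: BlancLewin2015, §1.2] -/
theorem cross_le_of_dock {w : Fin N → EuclideanSpace ℝ (Fin 3)} (hw : IsGroundState lennardJones w) (A : Finset (Fin N))
    (v : EuclideanSpace ℝ (Fin 3)) (h1 : ∀ a ∈ A, ∀ b ∈ Aᶜ, 1 ≤ dist (w a + v) (w b))
    (h2 : ∃ a ∈ A, ∃ b ∈ Aᶜ, dist (w a + v) (w b) ≤ 2) :
    ∑ a ∈ A, ∑ b ∈ Aᶜ, lennardJones (dist (w a) (w b)) ≤ -(1 / 1536) := by
  classical
  obtain ⟨a₁, ha₁, b₁, hb₁, hab⟩ := h2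
  set w' : Fin N → EuclideanSpace ℝ (Fin 3) := fun k => if k ∈ A then w k + v else w k with hw'
  have hwA : ∀ k ∈ A, w' k = w k + v := fun k hk => by simp [hw', hk]
  have hwAc : ∀ k ∈ Aᶜ, w' k = w k := fun k hk => by simp [hw', Finset.mem_compl.1 hk]
  have hw_inj : Function.Injective w' := by
    intro i k hik
    by_cases hi : i ∈ A <;> by_cases hk : k ∈ A
    · rw [hwA i hi, hwA k hk] at hik
      exact hw.1 (add_right_cancel hik)
    · exfalso
      have h := h1 i hi k (Finset.mem_compl.2 hk)
      rw [← hwA i hi, ← hwAc k (Finset.mem_compl.2 hk), hik, dist_self] at h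
      norm_num at h
    · exfalso
      have h := h1 k hk i (Finset.mem_compl.2 hi)
      rw [← hwA k hk, ← hwAc i (Finset.mem_compl.2 hi), hik, dist_self] at h
      norm_num at h
    · rw [hwAc i (Finset.mem_compl.2 hi), hwAc k (Finset.mem_compl.2 hk)] at hik
      exact hw.1 hik
  have hE : interactionEnergy lennardJones w ≤ interactionEnergy lennardJones w' := by
    rw [hw.2]; exact groundStateEnergy_lennardJones_le hw_inj
  have h2x := two_mul_interactionEnergy_eq_sum_sum lennardJones lennardJones_zero w
  have h2w := two_mul_interactionEnergy_eq_sum_sum lennardJones lennardJones_zero w'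
  rw [sum_sum_eq_add_compl _ A] at h2x h2w
  have hAA : ∑ i ∈ A, ∑ k ∈ A, lennardJones (dist (w' i) (w' k)) =
      ∑ i ∈ A, ∑ k ∈ A, lennardJones (dist (w i) (w k)) :=
    Finset.sum_congr rfl fun i hi => Finset.sum_congr rfl fun k hk => by
      rw [hwA i hi, hwA k hk, dist_add_right]
  have hAcAc : ∑ i ∈ Aᶜ, ∑ k ∈ Aᶜ, lennardJones (dist (w' i) (w' k)) =
      ∑ i ∈ Aᶜ, ∑ k ∈ Aᶜ, lennardJones (dist (w i) (w k)) :=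
    Finset.sum_congr rfl fun i hi => Finset.sum_congr rfl fun k hk => by rw [hwAc i hi, hwAc k hk]
  have hterm : ∀ i ∈ A, ∀ k ∈ Aᶜ, lennardJones (dist (w' i) (w' k)) ≤ 0 := fun i hi k hk => by
    rw [hwA i hi, hwAc k hk]; exact lennardJones_nonpos (h1 i hi k hk)
  have hsplit1 : (∑ k ∈ Aᶜ, lennardJones (dist (w' a₁) (w' k))) +
      ∑ i ∈ A.erase a₁, ∑ k ∈ Aᶜ, lennardJones (dist (w' i) (w' k)) =
        ∑ i ∈ A, ∑ k ∈ Aᶜ, lennardJones (dist (w' i) (w' k)) :=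
    Finset.add_sum_erase A (fun i => ∑ k ∈ Aᶜ, lennardJones (dist (w' i) (w' k))) ha₁
  have hsplit2 : lennardJones (dist (w' a₁) (w' b₁)) +
      ∑ k ∈ Aᶜ.erase b₁, lennardJones (dist (w' a₁) (w' k)) =
        ∑ k ∈ Aᶜ, lennardJones (dist (w' a₁) (w' k)) :=
    Finset.add_sum_erase Aᶜ (fun k => lennardJones (dist (w' a₁) (w' k))) hb₁
  have hrest1 : ∑ i ∈ A.erase a₁, ∑ k ∈ Aᶜ, lennardJones (dist (w' i) (w' k)) ≤ 0 :=
    Finset.sum_nonpos fun i hi => Finset.sum_nonpos fun k hk => hterm i (Finset.mem_of_mem_erase hi) k hk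
  have hrest2 : ∑ k ∈ Aᶜ.erase b₁, lennardJones (dist (w' a₁) (w' k)) ≤ 0 :=
    Finset.sum_nonpos fun k hk => hterm a₁ ha₁ k (Finset.mem_of_mem_erase hk)
  have hspecial : lennardJones (dist (w' a₁) (w' b₁)) ≤ -(1 / 768) := by
    rw [hwA a₁ ha₁, hwAc b₁ hb₁]
    exact lennardJones_le_of_mem_Icc (h1 a₁ ha₁ b₁ hb₁) hab
  have hcross2 : ∑ i ∈ Aᶜ, ∑ k ∈ A, lennardJones (dist (w' i) (w' k)) ≤ 0 :=
    Finset.sum_nonpos fun i hi => Finset.sum_nonpos fun k hk => by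
      rw [hwAc i hi, hwA k hk, dist_comm]; exact lennardJones_nonpos (h1 k hk i hi)
  have hsym : ∑ i ∈ Aᶜ, ∑ k ∈ A, lennardJones (dist (w i) (w k)) =
      ∑ i ∈ A, ∑ k ∈ Aᶜ, lennardJones (dist (w i) (w k)) := by
    rw [Finset.sum_comm]
    exact Finset.sum_congr rfl fun i _ => Finset.sum_congr rfl fun k _ => by rw [dist_comm]
  linarith

/-- **Bounded gaps.**  In a `δ`-separated Lennard-Jones ground state, every non-empty proper set `A` of particles
has a particle of `Aᶜ` within distance `64000 δ⁻⁵ #A + 2` of one of its particles: otherwise the cross energy is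
`> −1/1536` by the inverse-sixth-power tail beyond the gap, contradicting docking. [cite: BlancLewin2015, §1.2] -/
theorem exists_cross_pair_le {w : Fin N → EuclideanSpace ℝ (Fin 3)} (hw : IsGroundState lennardJones w) {δ : ℝ} (hδ : 0 < δ)
    (hsep : ∀ k l, k ≠ l → δ ≤ dist (w k) (w l)) (A : Finset (Fin N)) (hA : A.Nonempty)
    (hAc : Aᶜ.Nonempty) :
    ∃ a ∈ A, ∃ b ∈ Aᶜ, dist (w a) (w b) ≤ 64000 * δ⁻¹ ^ 5 * A.card + 2 := by
  by_contra hcon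
  push Not at hcon
  obtain ⟨a₀, ha₀⟩ := hA
  obtain ⟨b₀, hb₀⟩ := hAc
  set G : ℝ := 64000 * δ⁻¹ ^ 5 * A.card + 2 with hG
  have hG2 : 2 ≤ G := by
    have h : (0 : ℝ) ≤ 64000 * δ⁻¹ ^ 5 * A.card := by positivity
    linarith
  have hGpos : 0 < G := by linarith
  have hne : w a₀ ≠ w b₀ := fun h => by
    have h' := hcon a₀ ha₀ b₀ hb₀
    rw [h, dist_self] at h'
    linarith
  have hfar2 : ∀ a ∈ A, ∀ b ∈ Aᶜ, 2 < dist (w a) (w b) := fun a ha b hb =>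
    lt_of_le_of_lt hG2 (hcon a ha b hb)
  obtain ⟨t, ht1, ht2⟩ := exists_dock w A ha₀ hb₀ _ (norm_dir_eq_one (w a₀) (w b₀) hne)
    (dist_translate_line (w a₀) (w b₀) hne) hfar2
  have hup := cross_le_of_dock hw A _ ht1 ht2
  have hCne : ∀ a ∈ A, ∀ b ∈ Aᶜ, b ≠ a := fun a ha b hb hba => Finset.mem_compl.1 hb (hba ▸ ha)
  have hlow := FrustratedLawDichotomyWindowEnergyCeiling.cross_lennardJones_ge w hδ hsep A Aᶜ hCne
  have h6 : ∑ a ∈ A, ∑ b ∈ Aᶜ, (dist (w a) (w b))⁻¹ ^ 6 ≤ 250 * δ⁻¹ ^ 5 * G⁻¹ * A.card := by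
    have hrow : ∀ a ∈ A, ∑ b ∈ Aᶜ, (dist (w a) (w b))⁻¹ ^ 6 ≤ 250 * δ⁻¹ ^ 5 * G⁻¹ := fun a ha =>
      le_trans (Finset.sum_le_sum_of_subset_of_nonneg
        (fun b hb => Finset.mem_filter.2
          ⟨Finset.mem_erase.2 ⟨hCne a ha b hb, Finset.mem_univ b⟩, (hcon a ha b hb).le⟩)
        (fun b _ _ => by positivity)) (ChargedPeriodicOptimal.sum_inv_pow_six_far_le w hδ hsep a hGpos)
    refine le_trans (Finset.sum_le_sum hrow) ?_
    rw [Finset.sum_const, nsmul_eq_mul, mul_comm]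
  have hkey : (1 / 1536 : ℝ) ≤ 250 / 6 * δ⁻¹ ^ 5 * G⁻¹ * A.card := by linarith
  have hkey2 : G * (1 / 1536) ≤ 250 / 6 * δ⁻¹ ^ 5 * A.card := by
    have h := mul_le_mul_of_nonneg_left hkey hGpos.le
    rwa [show G * (250 / 6 * δ⁻¹ ^ 5 * G⁻¹ * (A.card : ℝ)) =
        250 / 6 * δ⁻¹ ^ 5 * (A.card : ℝ) * (G * G⁻¹) by ring, mul_inv_cancel₀ hGpos.ne', mul_one] at h
  have h7 : G ≤ 64000 * δ⁻¹ ^ 5 * A.card := by linarith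
  linarith

/-- Registered stub `stub_windowGrowth` (S3) of the crux `TexturedLawTransfer` (route FrustratedLawDichotomy,
stmt-AtomisticToContinuum-27625; skeleton line «truncated-bs»), with its registered signature: windows of
Lennard-Jones ground states fill up — every particle has `≥ n₀` particles within `r₀(n₀)` once `N ≥ n₀`
(bounded gaps by docking, then growth by induction). [cite: BlancLewin2015, §1.2] -/
theorem stub_windowGrowth : ∀ n₀ : ℕ, ∃ r₀ : ℝ, ∀ (N : ℕ) (w : Fin N → EuclideanSpace ℝ (Fin 3)), Literature.MathematicalPhysics.StatisticalMechanics.IsGroundState Literature.MathematicalPhysics.StatisticalMechanics.lennardJones w → n₀ ≤ N → ∀ i : Fin N, n₀ ≤ ((Finset.univ.filter (fun j : Fin N => dist (w j) (w i) ≤ r₀))).card := by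
  intro n₀
  obtain ⟨δ, hδ, hsepGS⟩ := LennardJonesMinimalDistance_holds
  set G : ℝ := 64000 * δ⁻¹ ^ 5 * n₀ + 2 with hG
  have hG0 : 0 ≤ G := by positivity
  refine ⟨n₀ * G, fun N w hw hN i => ?_⟩
  have hsep : ∀ k l, k ≠ l → δ ≤ dist (w k) (w l) := hsepGS N w hw
  have key : ∀ k : ℕ, 1 ≤ k → k ≤ n₀ → ∃ A : Finset (Fin N), i ∈ A ∧ A.card = k ∧
      ∀ a ∈ A, dist (w a) (w i) ≤ k * G := by
    intro k hk
    induction k, hk using Nat.le_induction with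
    | base =>
      intro _
      refine ⟨{i}, Finset.mem_singleton_self i, Finset.card_singleton i, fun a ha => ?_⟩
      rw [Finset.mem_singleton.1 ha, dist_self]
      push_cast
      linarith
    | succ k hk ih =>
      intro hkn
      obtain ⟨A, hiA, hcard, hdist⟩ := ih (Nat.le_of_succ_le hkn)
      have hAne : A.Nonempty := ⟨i, hiA⟩
      have hAcne : Aᶜ.Nonempty := by
        rw [← Finset.card_pos, Finset.card_compl, Fintype.card_fin, hcard]
        omega
      obtain ⟨a, ha, b, hb, hab⟩ := exists_cross_pair_le hw hδ hsep A hAne hAcne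
      have hbA : b ∉ A := Finset.mem_compl.1 hb
      have hkG : 64000 * δ⁻¹ ^ 5 * (A.card : ℝ) + 2 ≤ G := by
        have hc : (A.card : ℝ) ≤ n₀ := by rw [hcard]; exact_mod_cast Nat.le_of_succ_le hkn
        have := mul_le_mul_of_nonneg_left hc (by positivity : (0 : ℝ) ≤ 64000 * δ⁻¹ ^ 5)
        linarith
      refine ⟨insert b A, Finset.mem_insert_of_mem hiA,
        by rw [Finset.card_insert_of_notMem hbA, hcard], fun c hc => ?_⟩
      rcases Finset.mem_insert.1 hc with hcb | hcA
      · rw [hcb]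
        have h1 := dist_triangle (w b) (w a) (w i)
        have h2 : dist (w b) (w a) ≤ G := by rw [dist_comm]; exact le_trans hab hkG
        have h3 := hdist a ha
        push_cast
        linarith
      · have h := hdist c hcA
        push_cast
        linarith
  rcases Nat.eq_zero_or_pos n₀ with h0 | hpos
  · rw [h0]; exact Nat.zero_le _
  obtain ⟨A, -, hcard, hdist⟩ := key n₀ hpos le_rfl
  calc n₀ = A.card := hcard.symm
    _ ≤ _ := Finset.card_le_card fun a ha => Finset.mem_filter.2 ⟨Finset.mem_univ a, hdist a ha⟩

end Summit.AtomisticToContinuum.Crystallization.Theorems.FrustratedLawDichotomyWindowGrowth
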